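import Summits.QuantumFields.BalabanUV.T4Continuum.Support.NE7ApeCurvedRepSameTopCritical
import Summits.QuantumFields.BalabanUV.T4Continuum.Support.NE7PointedRepModGauge
import Summits.QuantumFields.BalabanUV.T4Continuum.Support.NE7PointedRepLinearisation
import HarnessLib

/-!
# NE7ApeCurvedRepPointedGauge — (APE) WITH A DATUM AT A TANGENT-CRITICAL BACKGROUND, ROAD (B): the representative of the orbit is `U^{u′} = W·e^{Z′}` with the
# POINTED gauge `u′ = e^{−σ̃}·u` built from ANY displayed representative `U^u = We^{Z}` (row NE3's E′) and ANY smooth extension `e^{σ̃}` of the corner values of `u`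
# — the top is kept EXACTLY (no LHCI, no Petrov–Galerkin), `Z′ = Z − gaugeDir_W σ̃ + N`, `‖N‖ ≤ 4(t+δ)(α+δ)`; (APE) ⇐ (L1)′ + α₁ + (L2) for such same-top fields; file 39

Cell `pub-balaban`, rung (B)+1 sub-cell t4, lineage `b2b-balaban-t4-ne7-p1` (CRUX PROVER NE7 #1 = OWNER of row NE7), generation 78; memo
`t4/b2b-balaban-t4-ne7-p1-g78/BUMP-CLASS-FLAT.md` §7.  File F108 (over F78 `NE7ApeCurvedRepSameTopCritical.smallField_of_tanCritical_repSameTop_critBackground` (the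
fibre-preserving docking — it never asked Landau-ness of the displayed `Z`), F105 `NE7PointedRepModGauge` (pointedness, same top), F106 `NE7PointedRepLinearisation`
(`Z′ = Z − gaugeDir_W σ̃ + O((t+δ)(α+δ))`), `NE7GradientCurrency` (closeness of `e^{T̂}e^{Z}e^{σ̃}` to `1`), `NE3.CurvedLandauNewtonStep.isSkewDir_mlog_rel ∕ isPeriodicDir_mlog_rel`).
WHY (memo §5∕§7).  [Balaban1985RegularSpaces] pp. 80–81 does not pin the Landau representative; gen 77 priced the resulting top mismatch at (L1) and went after a PINNED
representative (LHCI; flat case closed this gen, F95–F103).  Road (B) pins the GAUGE instead: `u′ := e^{−σ̃}u` is pointed for any extension `σ̃` of `log(u∘M•)`, so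
`U^{u′}` lies over `W`'s datum EXACTLY and F78 applies VERBATIM to the displayed pair `(u′, Z′ := log(W⁻¹U^{u′}))`: (L4) with `ω = 0`, (L3) with `κ = 0`.  The analytic
letters are F78's, quantified over the same-top fields of radius `α₀ ≥ α + δ + 4(t+δ)(α+δ)` that carry the STRUCTURE `‖Z′ − (Z − gaugeDir_W σ̃)‖ ≤ 4(t+δ)(α+δ)` (so the
providers may use that `Z` is Landau and `gaugeDir_W σ̃` is pure gauge — hHessGauge, F107).  Nothing of E′'s regime is needed here: `u`, `Z`, `σ̃` are DISPLAYED with their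
sizes (`‖Z‖ ≤ α`, `‖σ̃‖ ≤ t`, `‖gaugeDir_W σ̃‖ ≤ δ`, all `≤ 1∕40`); E′ (`exists_landauRep_W`, PROVED) and the corner-bump interpolation (F96) supply them.
WHAT ([folklore]; 0 def, 0 sorry).  **`smallField_of_tanCritical_pointedGauge`** — F78's conclusion (radius at `α₀`) from: the class data of `W` (tangent-critical) and
`U` (tangent-critical, same datum), the displayed `(u, Z, σ̃)`, and the letters (L1)′ (`hNlift`), α₁ (`hGrad`) over same-top structured fields, (L2) (`hG`).
HONEST FRAMING (page 1): composition + `exp`∕`log` kinematics; (L1)′, α₁, (L2) are HYPOTHESES; nothing of Bałaban's asserted; (APE) on curved data NOT proved; NOT ONE-STEP,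
NOT NE7; spine 0∕9; finite T⁴ rung (B)+1 — NOT infinite volume, NOT mass gap, NOT `BetaPertH`, NOT Clay.  Continuum YM on T⁴ ⇐ BetaPertH ∧ nine spine estimates (0/9
proved); BetaPertH ⇐ (D1) ∧ (D4) ∧ CAP+tail; G-an2-4 gates asym, D1 and NE2/3/4.
-/

set_option autoImplicit false

open scoped BigOperators Matrix Matrix.Norms.L2Operator
open NormedSpace Finset

namespace Summit.QuantumFields.BalabanUV.T4Continuum.NE7ApeCurvedRepPointedGauge

open Literature.MathematicalPhysics.QuantumFieldTheory.Balaban1983to89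
open B7Prop1Explicit B7Prop2Explicit MatrixLog UnitaryModel
open T4AveragingDeficitWall (Ad IsUnitaryCfg IsSkewDir SmallField vary curlAt dirL1)
open T4AveragingDeficitWallBoundary (IsPeriodicCfg periodBox)
open AveragingDeficitPeriodicCounting (IsPeriodicDir)
open AveragingDeficitTwoLevelPrep (twoLevelSmall)
open AveragingDeficitMultiLevelPrep (cavgIter LevelSmall)
open AveragingDeficitTransport (norm_Ad_of_unitary Ad_mem_skewAdjoint)
open MinimalActionLevels (perWin)
open BlockAverageVaryHolo (nbRad)
open BlockAveragePushDirGauge (gaugeDir)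
open NE3HessForm (hess dAction)
open NE3TangentCovariantTower (dirIter)
open NE3EnergyShapes (IsUnitarySite IsPeriodicSite)
open NE3QbarIterCovLiftPrep (cruxC)
open NE3RightInverseSolveLetters (thetaLoc)
open NE3HatInvCurlLetters (curl1C)
open NE3.CurvedLandauNewtonStep (isSkewDir_mlog_rel isPeriodicDir_mlog_rel isUnitaryCfg_gaugeAct_W)
open NE3ResidualSliceRep (isPeriodicCfg_gaugeAct)
open NE7ExpLogSecondOrder (real_exp_sub_one_le_two_mul)
open NE7GradientCurrency (norm_mul_sub_one_le_of_le norm_exp_sub_one_le)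
open NE7ApeCurvedRepSameTopCritical (smallField_of_tanCritical_repSameTop_critBackground)
open NE7PointedRepModGauge (cavgIter_pointed_eq)
open NE7PointedRepLinearisation (relLink_pointed_eq norm_mlog_relLink_pointed_sub_le)

noncomputable section

variable {d : ℕ} {n : Type*} [Fintype n] [DecidableEq n]

/-- **(APE) WITH A DATUM AT A TANGENT-CRITICAL BACKGROUND VIA THE POINTED GAUGE OF ROAD (B)** (statement in the module docstring). [folklore] -/
theorem smallField_of_tanCritical_pointedGauge [Nonempty n] (hd : 2 ≤ d) {L N : ℕ} [NeZero N] (hL : 2 ≤ L) (j : ℕ)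
    -- the background
    {W : Site d → Fin d → (Matrix n n ℂ)ˣ} {x : ℝ} (hWu : IsUnitaryCfg W) (hWP : IsPeriodicCfg W ((N * L ^ (j + 1) : ℕ) : ℤ))
    (hx : 0 ≤ x) (hs : LevelSmall d L j x) (hWx : SmallField W x)
    -- the sup radius of the representative and the regime at `x′ = x + 4(e^{α₀} − 1)`
    {α₀ : ℝ} (hα0 : 0 ≤ α₀) (hs' : LevelSmall d L j (x + 4 * (Real.exp α₀ - 1)))
    (hθ : cruxC d L * (((L : ℝ) ^ (j + 1)) ^ 2 * (x + 4 * (Real.exp α₀ - 1))) < 1)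
    (hθl : thetaLoc d L * (((L : ℝ) ^ (j + 1)) ^ 2 * (x + 4 * (Real.exp α₀ - 1))) < 1)
    (hε : ((L : ℝ) ^ (j + 1)) ^ 2 * (x + 4 * (Real.exp α₀ - 1)) ≤ 1)
    -- the field: of the class, tangent-critical, over `W`'s datum
    {U : Site d → Fin d → (Matrix n n ℂ)ˣ} (hUu : IsUnitaryCfg U) (hUP : IsPeriodicCfg U ((N * L ^ (j + 1) : ℕ) : ℤ))
    {xU : ℝ} (hxU : 0 ≤ xU) (hsU : LevelSmall d L j xU) (hUxU : SmallField U xU)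
    (hcritU : ∀ Y : Site d → Fin d → Matrix n n ℂ, IsSkewDir Y → IsPeriodicDir Y ((N * L ^ (j + 1) : ℕ) : ℤ) →
      dirIter L (j + 1) U Y = 0 → dAction U Y (perWin d (N * L ^ (j + 1))) = 0)
    (hTopUW : cavgIter L (j + 1) U = cavgIter L (j + 1) W)
    -- the DISPLAYED representative `U^u = W e^{Z}` (E′) and the DISPLAYED extension `e^{σ̃}` of the corner values of `u`
    {u : Site d → (Matrix n n ℂ)ˣ} (huU : IsUnitarySite u) (huP : IsPeriodicSite u ((N * L ^ (j + 1) : ℕ) : ℤ))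
    {Z : Site d → Fin d → Matrix n n ℂ} (hrep : gaugeAct u U = vary W Z 1) {α : ℝ} (hZα : ∀ y μ, ‖Z y μ‖ ≤ α) (hα40 : α ≤ 1 / 40)
    {σ : Site d → Matrix n n ℂ} (hσs : ∀ y, σ y ∈ skewAdjoint (Matrix n n ℂ)) (hσP : ∀ (y : Site d) (i : Fin d), σ (y + ((N * L ^ (j + 1) : ℕ) : ℤ) • e i) = σ y)
    (hext : ∀ w : Site d, expUnit (σ ((((L ^ (j + 1) : ℕ) : ℤ)) • w)) = u ((((L ^ (j + 1) : ℕ) : ℤ)) • w))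
    {t δ : ℝ} (hσt : ∀ y, ‖σ y‖ ≤ t) (hσδ : ∀ (y : Site d) (κ : Fin d), ‖gaugeDir W σ y κ‖ ≤ δ) (ht40 : t ≤ 1 / 40) (hδ40 : δ ≤ 1 / 40)
    (hα₀ : α + δ + 4 * (t + δ) * (α + δ) ≤ α₀)
    -- the remaining analytic letters at `W`: (L1)′ and α₁ for the SAME-TOP structured fields of radius `α₀`, (L2), (L3) discharged
    (S : Set (Site d → Fin d → Matrix n n ℂ)) {cN KG ν : ℝ} (hν : 0 ≤ ν)
    (hNlift : ∀ Z' : Site d → Fin d → Matrix n n ℂ, IsSkewDir Z' → IsPeriodicDir Z' ((N * L ^ (j + 1) : ℕ) : ℤ) →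
      (∀ y μ, ‖Z' y μ‖ ≤ α₀) → cavgIter L (j + 1) (vary W Z' 1) = cavgIter L (j + 1) W →
      (∀ (y : Site d) (μ : Fin d), ‖Z' y μ - (Z y μ - gaugeDir W σ y μ)‖ ≤ 4 * (t + δ) * (α + δ)) →
      ∃ AN : Site d → Fin d → Matrix n n ℂ, IsPeriodicDir AN ((N * L ^ (j + 1) : ℕ) : ℤ) ∧
        dirIter L (j + 1) W AN = dirIter L (j + 1) W Z' ∧
        (∀ z μ' ν', μ' ≠ ν' → ‖curlAt W AN z μ' ν'‖ ≤ cN) ∧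
        (∀ Y : Site d → Fin d → Matrix n n ℂ, IsSkewDir Y → IsPeriodicDir Y ((N * L ^ (j + 1) : ℕ) : ℤ) → dirIter L (j + 1) W Y = 0 →
          |hess W AN Y (perWin d (N * L ^ (j + 1)))| ≤ ν * dirL1 Y (periodBox (d := d) (N * L ^ (j + 1)))) ∧
        (fun y μ => Z' y μ - AN y μ) ∈ S)
    {α₁ : ℝ} (hα1 : 0 ≤ α₁)
    (hGrad : ∀ Z' : Site d → Fin d → Matrix n n ℂ, IsSkewDir Z' → IsPeriodicDir Z' ((N * L ^ (j + 1) : ℕ) : ℤ) →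
      (∀ y μ, ‖Z' y μ‖ ≤ α₀) → cavgIter L (j + 1) (vary W Z' 1) = cavgIter L (j + 1) W →
      (∀ (y : Site d) (μ : Fin d), ‖Z' y μ - (Z y μ - gaugeDir W σ y μ)‖ ≤ 4 * (t + δ) * (α + δ)) →
      ∀ (y : Site d) (κ τ : Fin d), ‖Ad (W (y + e κ) τ) (Z' (y + e τ) κ) - Z' y κ‖ ≤ α₁)
    (hG : ∀ X ∈ S, IsPeriodicDir X ((N * L ^ (j + 1) : ℕ) : ℤ) → dirIter L (j + 1) W X = 0 → ∀ g : ℝ, 0 ≤ g →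
      (∀ Y : Site d → Fin d → Matrix n n ℂ, IsSkewDir Y → IsPeriodicDir Y ((N * L ^ (j + 1) : ℕ) : ℤ) → dirIter L (j + 1) W Y = 0 →
        |hess W X Y (perWin d (N * L ^ (j + 1)))| ≤ g * dirL1 Y (periodBox (d := d) (N * L ^ (j + 1)))) →
      ∀ z μ' ν', μ' ≠ ν' → ‖curlAt W X z μ' ν'‖ ≤ KG * g)
    (hcritW : ∀ Y : Site d → Fin d → Matrix n n ℂ, IsSkewDir Y → IsPeriodicDir Y ((N * L ^ (j + 1) : ℕ) : ℤ) → dirIter L (j + 1) W Y = 0 →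
      dAction W Y (perWin d (N * L ^ (j + 1))) = 0) :
    SmallField U (x + (KG * (
        ((x + 4 * (Real.exp α₀ - 1))
            * ((curl1C d L / (1 - thetaLoc d L * (((L : ℝ) ^ (j + 1)) ^ 2 * (x + 4 * (Real.exp α₀ - 1)))))
                * (((L : ℝ) ^ (j + 1)) ^ d / ((L : ℝ) ^ (j + 1)) ^ 2))
            * (Real.exp (((L : ℝ) ^ d / L) * ((d : ℝ) * (16 * ((d : ℝ) + 1) * ((d : ℝ) + 4) * (L : ℝ) ^ 2)
                  * (1250 * ((nbRad d L : ℝ) + L) + 8 * ((d : ℝ) * L) + 2 * L)) * (2 / twoLevelSmall d L))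
                * ((L : ℝ) / (L : ℝ) ^ d) ^ j
                * (((d : ℝ) * (2 * nbRad d L + 1) ^ d) * ((2 * (d : ℝ) + 4) * (L : ℝ) ^ 2) * (2 * (L : ℝ) ^ j) * (Real.exp α₀ - 1)
                  + (17 / 8 * ((L : ℝ) ^ 2) ^ j * (x + 4 * (Real.exp α₀ - 1)))
                    * (((d : ℝ) * (2 * nbRad d L + 1) ^ d) * ((2 * (d : ℝ) + 4)
                          * (2 * (2 * L * (nbRad d L : ℝ) + 128 * ((d : ℝ) + 1) * ((d : ℝ) + 4) * (L : ℝ) ^ 2)))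
                      + ((d : ℝ) * (2 * nbRad d L + 1) ^ d) * ((2 * (d : ℝ) + 4) * (L : ℝ) ^ 2 * (2 * (nbRad d L : ℝ))
                          + 2 * (8 * (L : ℝ) + (1250 * ((nbRad d L : ℝ) + L) + 8 * (d * L) + 2 * L))
                              * (16 * ((d : ℝ) + 1) * ((d : ℝ) + 4) * (L : ℝ) ^ 2))))))
        + (Fintype.card (T4AveragingDeficitWall.Plane d) : ℝ)
          * (2 * (240 * (Real.exp α₀ - 1) * α₀ * (2 * α₁ + 24 * α₀ * (Real.exp α₀ - 1) + x) + 8 * α₀ * (2 * α₁ + 24 * α₀ * (Real.exp α₀ - 1))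
              + 6 * (Real.exp α₀ - 1) * (2 * α₁ + 24 * (Real.exp α₀ - 1) * α₀)
              + (2 * α₁ + 24 * (Real.exp α₀ - 1) * α₀) * (2 * α₁ + 24 * α₀ * (Real.exp α₀ - 1))
              + 960 * (Real.exp α₀ - 1) * α₀ ^ 2 + 32 * x * α₀ ^ 2)
            + (64 * α₀ * α₁ + 1024 * x * α₀ ^ 2))
        + ν) + cN + 28 * α₀ ^ 2)) := by
  letI : CStarAlgebra (Matrix n n ℂ) := {}
  letI : NormedAlgebra ℚ (Matrix n n ℂ) := NormedAlgebra.restrictScalars ℚ ℝ (Matrix n n ℂ)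
  have hL1 : 1 ≤ L := by omega
  have ht0 : 0 ≤ t := (norm_nonneg _).trans (hσt 0)
  have hαZ0 : 0 ≤ α := (norm_nonneg _).trans (hZα 0 ⟨0, by omega⟩)
  have hδ0 : 0 ≤ δ := (norm_nonneg _).trans (hσδ 0 ⟨0, by omega⟩)
  -- the extension `c̃ = e^{σ̃}` and the pointed gauge `u′ = c̃⁻¹ u`
  set ct : Site d → (Matrix n n ℂ)ˣ := fun y => expUnit (σ y) with hct
  have hcU : IsUnitarySite ct := fun y => mem_unitaryUnits.mpr (by rw [hct, val_expUnit]; exact exp_mem_unitary_of_mem_skewAdjoint (hσs y))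
  have hcP : IsPeriodicSite ct ((N * L ^ (j + 1) : ℕ) : ℤ) := fun y i => by simp only [hct, hσP y i]
  set u' : Site d → (Matrix n n ℂ)ˣ := fun y => (ct y)⁻¹ * u y with hu'
  have hu'U : IsUnitarySite u' := fun y => (unitaryUnits _).mul_mem ((unitaryUnits _).inv_mem (hcU y)) (huU y)
  have hu'P : IsPeriodicSite u' ((N * L ^ (j + 1) : ℕ) : ℤ) := fun y i => by simp only [hu', hcP y i, huP y i]
  have hVu : IsUnitaryCfg (gaugeAct u' U) := isUnitaryCfg_gaugeAct_W hu'U hUu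
  have hVP : IsPeriodicCfg (gaugeAct u' U) ((N * L ^ (j + 1) : ℕ) : ℤ) := isPeriodicCfg_gaugeAct hu'P hUP
  -- closeness of the relative link `W⁻¹U^{u′} = e^{T̂}e^{Z}e^{σ̃'}` to `1`: `≤ e^{2t+α} − 1 ≤ 2(2t + α) ≤ 1∕4`
  have hclose : ∀ (y : Site d) (μ : Fin d), ‖(((W y μ)⁻¹ * gaugeAct u' U y μ : (Matrix n n ℂ)ˣ) : Matrix n n ℂ) - 1‖ ≤ 2 * (2 * t + α) := by
    intro y μ
    rw [hu', relLink_pointed_eq hrep σ y μ]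
    have hWi : (W y μ)⁻¹ ∈ unitaryUnits (Matrix n n ℂ) := (unitaryUnits _).inv_mem (hWu y μ)
    have h1 : ‖exp (Ad (W y μ)⁻¹ (-σ y)) - 1‖ ≤ Real.exp t - 1 :=
      norm_exp_sub_one_le (by rw [norm_Ad_of_unitary hWi, norm_neg]; exact hσt y)
    have h2 : ‖exp (Z y μ) - 1‖ ≤ Real.exp α - 1 := norm_exp_sub_one_le (hZα y μ)
    have h3 : ‖exp (-(-σ (y + e μ))) - 1‖ ≤ Real.exp t - 1 := norm_exp_sub_one_le (by rw [neg_neg]; exact hσt _)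
    have h12 := norm_mul_sub_one_le_of_le h1 h2
    have h123 := norm_mul_sub_one_le_of_le h12 h3
    have hexp : Real.exp t * Real.exp α * Real.exp t = Real.exp (2 * t + α) := by
      rw [← Real.exp_add, ← Real.exp_add]; ring_nf
    have hsmall : Real.exp (2 * t + α) - 1 ≤ 2 * (2 * t + α) := real_exp_sub_one_le_two_mul (by positivity) (by linarith)
    linarith [h123]
  have hquarter : 2 * (2 * t + α) ≤ 1 / 4 := by linarith
  -- the same-top representative `Z′ := log(W⁻¹U^{u′})`
  set Z' : Site d → Fin d → Matrix n n ℂ := fun y μ => mlog (((W y μ)⁻¹ * gaugeAct u' U y μ : (Matrix n n ℂ)ˣ) : Matrix n n ℂ) with hZ'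
  have hZ's : IsSkewDir Z' := isSkewDir_mlog_rel hWu hVu fun y μ => (hclose y μ).trans hquarter
  have hZ'P : IsPeriodicDir Z' ((N * L ^ (j + 1) : ℕ) : ℤ) := isPeriodicDir_mlog_rel hWP hVP
  have hrep' : gaugeAct u' U = vary W Z' 1 := by
    funext y μ
    refine Units.ext ?_
    have h1 : ‖(((W y μ)⁻¹ * gaugeAct u' U y μ : (Matrix n n ℂ)ˣ) : Matrix n n ℂ) - 1‖ < 1 := (hclose y μ).trans_lt (by linarith)
    have h2 : exp (Z' y μ) = (((W y μ)⁻¹ * gaugeAct u' U y μ : (Matrix n n ℂ)ˣ) : Matrix n n ℂ) := exp_mlog h1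
    rw [show (vary W Z' 1 y μ : (Matrix n n ℂ)ˣ) = W y μ * expUnit (((1 : ℝ) : ℂ) • Z' y μ) from rfl, Units.val_mul, val_expUnit,
      Complex.ofReal_one, one_smul, h2, Units.val_mul, ← mul_assoc, Units.mul_inv, one_mul]
  -- the structure and the radius of `Z′`
  have hstruct : ∀ (y : Site d) (μ : Fin d), ‖Z' y μ - (Z y μ - gaugeDir W σ y μ)‖ ≤ 4 * (t + δ) * (α + δ) := fun y μ => by
    rw [hZ', hu']; exact norm_mlog_relLink_pointed_sub_le hWu hrep hσs hσt hZα hσδ ht40 hα40 hδ40 y μ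
  have hZ'α : ∀ y μ, ‖Z' y μ‖ ≤ α₀ := by
    intro y μ
    have e1 : Z' y μ = (Z' y μ - (Z y μ - gaugeDir W σ y μ)) + (Z y μ - gaugeDir W σ y μ) := by abel
    rw [e1]
    calc ‖(Z' y μ - (Z y μ - gaugeDir W σ y μ)) + (Z y μ - gaugeDir W σ y μ)‖
        ≤ ‖Z' y μ - (Z y μ - gaugeDir W σ y μ)‖ + ‖Z y μ - gaugeDir W σ y μ‖ := norm_add_le _ _
      _ ≤ 4 * (t + δ) * (α + δ) + (α + δ) := add_le_add (hstruct y μ) ((norm_sub_le _ _).trans (add_le_add (hZα y μ) (hσδ y μ)))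
      _ ≤ α₀ := by linarith
  -- the top is kept: `cavgIter (We^{Z′}) = cavgIter (U^{u′}) = cavgIter U = cavgIter W`
  have hext' : ∀ w : Site d, ct (((L : ℤ) ^ (j + 1)) • w) = u (((L : ℤ) ^ (j + 1)) • w) := fun w => by
    have h := hext w
    push_cast at h
    simpa only [hct] using h
  have hTopZ' : cavgIter L (j + 1) (vary W Z' 1) = cavgIter L (j + 1) W := by
    rw [← hrep', ← hTopUW]
    exact cavgIter_pointed_eq hL1 j hUu hxU hsU hUxU huU hcU hext'
  -- the letters at `Z′`, and F78
  obtain ⟨AN, hNP, hNexact, hN7, hNorth, hTS⟩ := hNlift Z' hZ's hZ'P hZ'α hTopZ' hstruct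
  have hZ1 := hGrad Z' hZ's hZ'P hZ'α hTopZ' hstruct
  exact smallField_of_tanCritical_repSameTop_critBackground hd hL j hWu hWP hx hs hWx hα0 hs' hθ hθl hε hUu hxU hsU hUxU hcritU hu'U hu'P hZ's hZ'P hrep' hZ'α hTopZ'
    S hν hNP hNexact hN7 hNorth hTS hα1 hZ1 hG hcritW

end

end Summit.QuantumFields.BalabanUV.T4Continuum.NE7ApeCurvedRepPointedGauge
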